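import Summits.CriticalPhenomena.PercolationContinuityZ3.Theorems.PercNearOneGluingNoHeavyLowerTailThreePartitionDecoupled

/-!
# Conjecture V from a unit matching: the Hall form of `vSumT ≥ 0` (support file)

Support file (prover seat `prim-bnk-2`, gen 31; `--supports stmt-CriticalPhenomena-4575`).  Memos:
`run/shared/lean/prim/prim-l12/prim-bnk-2/FROM-prim-bnk-2-g30-ONE-SHARED-SCHEME.md` §3 (SCHEME Σ) and
`run/shared/lean/prim/prim-l12/FROM-prim-bnk-2-g31-COMPRESSION-THEOREM.md` §5.

Conjecture V (`VOrderPositivity`, file `…ThreePartitionVOrder`) asks that the kernel sum `vSumT τ 𝒱 𝒲 𝒳` over the faces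
`(a,b,c)` with `(a,b) ∈ 𝒳` be `≥ 0` for every up-set `𝒳` of the copy order.  In typed units (`vSumT_eq_units`, file
`…ThreePartitionDecoupled`): `vSumT = (T1⁺ + T2⁺ + T3⁺) − (T1⁻ + T2⁻ + T3⁻)` with
`T1⁺ = [a∈𝒱𝒲][c∉𝒱]`, `T2⁺ = [a∈𝒱𝒲][c∉𝒲]`, `T3⁺ = [c∈𝒱∖𝒲][b∈𝒲]`, `T1⁻ = [a∈𝒲∖𝒱][c∈𝒱]`, `T2⁻ = [a∈𝒱∖𝒲][c∈𝒲]`,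
`T3⁻ = [c∈𝒱𝒲][b∉𝒲]`.  Every matching-based proof (the programme's SCHEME Σ for one-shared-coordinate pairs, g30 `sigma.py`;
the matching disciplines of g23–g29) produces an INJECTION of the negative units into the positive units which moves UP in the
copy order (`a ⊆ a'`, `b ⊆ b'`).  This file records once and for all that such an injection gives `vSumT τ 𝒱 𝒲 𝒳 ≥ 0` for EVERY
up-set `𝒳` (`vSumT_nonneg_of_unitMatching`): the negative units inside `𝒳` land injectively on positive units inside `𝒳`.

Units are encoded as `((S₁,S₂), t)`: the untwisted first two parts of the face and a type `t ∈ {0,1,2}` (`T1, T2, T3`);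
`negUnitSet` / `posUnitSet` are the two unit sets (copies `a = S₁ ∆ τ`, `b = S₂ ∆ τ`, `c = (S₁ ∪ S₂)ᶜ ∆ τ`), with exactly the
unit types of `…ThreePartitionDecoupled` and of `sigma.py`.  Two plumbing definitions (sets of units); no `sorry`; standard axioms.
-/

noncomputable section

open Finset
open scoped symmDiff Classical

namespace Summit.CriticalPhenomena.PercolationContinuityZ3.Theorems.ThreePartition

variable {ι : Type*} [Fintype ι]

/-! ## Units -/

/-- The negative units of `(τ, 𝒱, 𝒲)`: pairs `((S₁,S₂), t)` with `(S₁,S₂)` the untwisted first two parts of a face (disjoint)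
and `t` the type — `t = 0`: `T1⁻ = [a∈𝒲∖𝒱][c∈𝒱]`, `t = 1`: `T2⁻ = [a∈𝒱∖𝒲][c∈𝒲]`, `t = 2`: `T3⁻ = [c∈𝒱𝒲][b∉𝒲]`
(copies `a = S₁ ∆ τ`, `b = S₂ ∆ τ`, `c = (S₁ ∪ S₂)ᶜ ∆ τ`). [this work] -/
def negUnitSet (τ : Set ι) (𝒱 𝒲 : Set (Set ι)) : Set ((Set ι × Set ι) × ℕ) :=
  {u | Disjoint u.1.1 u.1.2 ∧
    ((u.2 = 0 ∧ (u.1.1 ∆ τ ∈ 𝒲 ∧ u.1.1 ∆ τ ∉ 𝒱) ∧ (u.1.1 ∪ u.1.2)ᶜ ∆ τ ∈ 𝒱) ∨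
      (u.2 = 1 ∧ (u.1.1 ∆ τ ∈ 𝒱 ∧ u.1.1 ∆ τ ∉ 𝒲) ∧ (u.1.1 ∪ u.1.2)ᶜ ∆ τ ∈ 𝒲) ∨
      (u.2 = 2 ∧ ((u.1.1 ∪ u.1.2)ᶜ ∆ τ ∈ 𝒱 ∧ (u.1.1 ∪ u.1.2)ᶜ ∆ τ ∈ 𝒲) ∧ u.1.2 ∆ τ ∉ 𝒲))}

/-- The positive units of `(τ, 𝒱, 𝒲)`: `t = 0`: `T1⁺ = [a∈𝒱𝒲][c∉𝒱]`, `t = 1`: `T2⁺ = [a∈𝒱𝒲][c∉𝒲]`,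
`t = 2`: `T3⁺ = [c∈𝒱∖𝒲][b∈𝒲]` (copies `a = S₁ ∆ τ`, `b = S₂ ∆ τ`, `c = (S₁ ∪ S₂)ᶜ ∆ τ`). [this work] -/
def posUnitSet (τ : Set ι) (𝒱 𝒲 : Set (Set ι)) : Set ((Set ι × Set ι) × ℕ) :=
  {u | Disjoint u.1.1 u.1.2 ∧
    ((u.2 = 0 ∧ (u.1.1 ∆ τ ∈ 𝒱 ∧ u.1.1 ∆ τ ∈ 𝒲) ∧ (u.1.1 ∪ u.1.2)ᶜ ∆ τ ∉ 𝒱) ∨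
      (u.2 = 1 ∧ (u.1.1 ∆ τ ∈ 𝒱 ∧ u.1.1 ∆ τ ∈ 𝒲) ∧ (u.1.1 ∪ u.1.2)ᶜ ∆ τ ∉ 𝒲) ∨
      (u.2 = 2 ∧ ((u.1.1 ∪ u.1.2)ᶜ ∆ τ ∈ 𝒱 ∧ (u.1.1 ∪ u.1.2)ᶜ ∆ τ ∉ 𝒲) ∧ u.1.2 ∆ τ ∈ 𝒲))}

/-! ## Twisted counts as cardinalities of face classes -/

/-- A twisted count whose predicate starts with `(a,b) ∈ 𝒳` is the size of a class of faces with `(a,b) ∈ 𝒳`. [this work] -/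
theorem triT_mem_and_eq_card (τ : Set ι) (𝒳 : Set (Set ι × Set ι)) (p : Set ι → Set ι → Set ι → Prop) :
    triT τ (fun a b c => (a, b) ∈ 𝒳 ∧ p a b c) =
      #((univ.filter fun q : Set ι × Set ι => Disjoint q.1 q.2 ∧ (q.1 ∆ τ, q.2 ∆ τ) ∈ 𝒳).filter
          fun q => p (q.1 ∆ τ) (q.2 ∆ τ) ((q.1 ∪ q.2)ᶜ ∆ τ)) := by
  unfold triT tri
  congr 1
  ext q
  simp only [mem_filter, mem_univ, true_and, and_assoc]

/-! ## The Hall form of Conjecture V -/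

/-- **Conjecture V from a unit matching.**  If the negative units of `(τ, 𝒱, 𝒲)` can be mapped injectively to positive units,
each to a unit at a face above it in the copy order (`a ⊆ a'`, `b ⊆ b'`), then `vSumT τ 𝒱 𝒲 𝒳 ≥ 0` for every up-set `𝒳` of the
copy order (units: `negUnitSet`, `posUnitSet`). [this work] -/
theorem vSumT_nonneg_of_unitMatching (τ : Set ι) (𝒱 𝒲 : Set (Set ι))
    (φ : (Set ι × Set ι) × ℕ → (Set ι × Set ι) × ℕ)
    (hφ : ∀ u ∈ negUnitSet τ 𝒱 𝒲,
      φ u ∈ posUnitSet τ 𝒱 𝒲 ∧ u.1.1 ∆ τ ⊆ (φ u).1.1 ∆ τ ∧ u.1.2 ∆ τ ⊆ (φ u).1.2 ∆ τ)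
    (hinj : Set.InjOn φ (negUnitSet τ 𝒱 𝒲))
    (𝒳 : Set (Set ι × Set ι)) (h𝒳 : IsUpperSet 𝒳) : 0 ≤ vSumT τ 𝒱 𝒲 𝒳 := by
  -- faces in `𝒳` and the six unit classes
  set D : Finset (Set ι × Set ι) :=
    univ.filter (fun q : Set ι × Set ι => Disjoint q.1 q.2 ∧ (q.1 ∆ τ, q.2 ∆ τ) ∈ 𝒳) with hD
  have memD : ∀ q, q ∈ D ↔ Disjoint q.1 q.2 ∧ (q.1 ∆ τ, q.2 ∆ τ) ∈ 𝒳 := fun q => by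
    rw [hD, mem_filter]; exact ⟨fun h => h.2, fun h => ⟨mem_univ _, h⟩⟩
  set A₀ : Finset (Set ι × Set ι) :=
    D.filter (fun q => (q.1 ∆ τ ∈ 𝒲 ∧ q.1 ∆ τ ∉ 𝒱) ∧ (q.1 ∪ q.2)ᶜ ∆ τ ∈ 𝒱) with hA₀
  set A₁ : Finset (Set ι × Set ι) :=
    D.filter (fun q => (q.1 ∆ τ ∈ 𝒱 ∧ q.1 ∆ τ ∉ 𝒲) ∧ (q.1 ∪ q.2)ᶜ ∆ τ ∈ 𝒲) with hA₁
  set A₂ : Finset (Set ι × Set ι) :=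
    D.filter (fun q => ((q.1 ∪ q.2)ᶜ ∆ τ ∈ 𝒱 ∧ (q.1 ∪ q.2)ᶜ ∆ τ ∈ 𝒲) ∧ q.2 ∆ τ ∉ 𝒲) with hA₂
  set B₀ : Finset (Set ι × Set ι) :=
    D.filter (fun q => (q.1 ∆ τ ∈ 𝒱 ∧ q.1 ∆ τ ∈ 𝒲) ∧ (q.1 ∪ q.2)ᶜ ∆ τ ∉ 𝒱) with hB₀
  set B₁ : Finset (Set ι × Set ι) :=
    D.filter (fun q => (q.1 ∆ τ ∈ 𝒱 ∧ q.1 ∆ τ ∈ 𝒲) ∧ (q.1 ∪ q.2)ᶜ ∆ τ ∉ 𝒲) with hB₁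
  set B₂ : Finset (Set ι × Set ι) :=
    D.filter (fun q => ((q.1 ∪ q.2)ᶜ ∆ τ ∈ 𝒱 ∧ (q.1 ∪ q.2)ᶜ ∆ τ ∉ 𝒲) ∧ q.2 ∆ τ ∈ 𝒲) with hB₂
  have hN₀ : triT τ (fun a b c => (a, b) ∈ 𝒳 ∧ (a ∈ 𝒲 ∧ a ∉ 𝒱) ∧ c ∈ 𝒱) = #A₀ := by
    rw [triT_mem_and_eq_card]
    refine congrArg Finset.card ?_
    ext q
    simp only [hA₀, mem_filter, mem_univ, true_and, memD]
  have hN₁ : triT τ (fun a b c => (a, b) ∈ 𝒳 ∧ (a ∈ 𝒱 ∧ a ∉ 𝒲) ∧ c ∈ 𝒲) = #A₁ := by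
    rw [triT_mem_and_eq_card]
    refine congrArg Finset.card ?_
    ext q
    simp only [hA₁, mem_filter, mem_univ, true_and, memD]
  have hN₂ : triT τ (fun a b c => (a, b) ∈ 𝒳 ∧ (c ∈ 𝒱 ∧ c ∈ 𝒲) ∧ b ∉ 𝒲) = #A₂ := by
    rw [triT_mem_and_eq_card]
    refine congrArg Finset.card ?_
    ext q
    simp only [hA₂, mem_filter, mem_univ, true_and, memD]
  have hP₀ : triT τ (fun a b c => (a, b) ∈ 𝒳 ∧ (a ∈ 𝒱 ∧ a ∈ 𝒲) ∧ c ∉ 𝒱) = #B₀ := by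
    rw [triT_mem_and_eq_card]
    refine congrArg Finset.card ?_
    ext q
    simp only [hB₀, mem_filter, mem_univ, true_and, memD]
  have hP₁ : triT τ (fun a b c => (a, b) ∈ 𝒳 ∧ (a ∈ 𝒱 ∧ a ∈ 𝒲) ∧ c ∉ 𝒲) = #B₁ := by
    rw [triT_mem_and_eq_card]
    refine congrArg Finset.card ?_
    ext q
    simp only [hB₁, mem_filter, mem_univ, true_and, memD]
  have hP₂ : triT τ (fun a b c => (a, b) ∈ 𝒳 ∧ (c ∈ 𝒱 ∧ c ∉ 𝒲) ∧ b ∈ 𝒲) = #B₂ := by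
    rw [triT_mem_and_eq_card]
    refine congrArg Finset.card ?_
    ext q
    simp only [hB₂, mem_filter, mem_univ, true_and, memD]
  -- negative and positive units inside `𝒳`
  set N : Finset ((Set ι × Set ι) × ℕ) := (D ×ˢ range 3).filter (fun u => u ∈ negUnitSet τ 𝒱 𝒲) with hN
  set P : Finset ((Set ι × Set ι) × ℕ) := (D ×ˢ range 3).filter (fun u => u ∈ posUnitSet τ 𝒱 𝒲) with hP
  have hNeq : N = A₀.image (fun q => (q, 0)) ∪ A₁.image (fun q => (q, 1)) ∪ A₂.image (fun q => (q, 2)) := by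
    ext ⟨q, t⟩
    simp only [hN, hA₀, hA₁, hA₂, mem_filter, mem_product, mem_range, mem_union, mem_image, negUnitSet,
      Set.mem_setOf_eq, Prod.mk.injEq]
    constructor
    · rintro ⟨⟨hq, -⟩, -, ⟨rfl, h⟩ | ⟨rfl, h⟩ | ⟨rfl, h⟩⟩
      · exact Or.inl (Or.inl ⟨q, ⟨hq, h⟩, rfl, rfl⟩)
      · exact Or.inl (Or.inr ⟨q, ⟨hq, h⟩, rfl, rfl⟩)
      · exact Or.inr ⟨q, ⟨hq, h⟩, rfl, rfl⟩
    · rintro ((⟨q', ⟨hq', h⟩, rfl, rfl⟩ | ⟨q', ⟨hq', h⟩, rfl, rfl⟩) | ⟨q', ⟨hq', h⟩, rfl, rfl⟩)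
      · exact ⟨⟨hq', by norm_num⟩, ((memD _).1 hq').1, Or.inl ⟨rfl, h⟩⟩
      · exact ⟨⟨hq', by norm_num⟩, ((memD _).1 hq').1, Or.inr (Or.inl ⟨rfl, h⟩)⟩
      · exact ⟨⟨hq', by norm_num⟩, ((memD _).1 hq').1, Or.inr (Or.inr ⟨rfl, h⟩)⟩
  have hPeq : P = B₀.image (fun q => (q, 0)) ∪ B₁.image (fun q => (q, 1)) ∪ B₂.image (fun q => (q, 2)) := by
    ext ⟨q, t⟩
    simp only [hP, hB₀, hB₁, hB₂, mem_filter, mem_product, mem_range, mem_union, mem_image, posUnitSet,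
      Set.mem_setOf_eq, Prod.mk.injEq]
    constructor
    · rintro ⟨⟨hq, -⟩, -, ⟨rfl, h⟩ | ⟨rfl, h⟩ | ⟨rfl, h⟩⟩
      · exact Or.inl (Or.inl ⟨q, ⟨hq, h⟩, rfl, rfl⟩)
      · exact Or.inl (Or.inr ⟨q, ⟨hq, h⟩, rfl, rfl⟩)
      · exact Or.inr ⟨q, ⟨hq, h⟩, rfl, rfl⟩
    · rintro ((⟨q', ⟨hq', h⟩, rfl, rfl⟩ | ⟨q', ⟨hq', h⟩, rfl, rfl⟩) | ⟨q', ⟨hq', h⟩, rfl, rfl⟩)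
      · exact ⟨⟨hq', by norm_num⟩, ((memD _).1 hq').1, Or.inl ⟨rfl, h⟩⟩
      · exact ⟨⟨hq', by norm_num⟩, ((memD _).1 hq').1, Or.inr (Or.inl ⟨rfl, h⟩)⟩
      · exact ⟨⟨hq', by norm_num⟩, ((memD _).1 hq').1, Or.inr (Or.inr ⟨rfl, h⟩)⟩
  -- counting the units by type
  have himg_disj : ∀ (X Y : Finset (Set ι × Set ι)) (i j : ℕ), i ≠ j →
      Disjoint (X.image (fun q => (q, i))) (Y.image (fun q => (q, j))) := by
    intro X Y i j hij
    refine disjoint_left.2 fun u hu hu' => hij ?_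
    obtain ⟨q, -, rfl⟩ := mem_image.1 hu
    obtain ⟨q', -, h⟩ := mem_image.1 hu'
    exact ((Prod.ext_iff.1 h).2).symm
  have himg_card : ∀ (X : Finset (Set ι × Set ι)) (i : ℕ), #(X.image (fun q => (q, i))) = #X := fun X i =>
    card_image_of_injective _ fun q q' h => (Prod.ext_iff.1 h).1
  have hNcard : #N = #A₀ + #A₁ + #A₂ := by
    rw [hNeq, card_union_of_disjoint, card_union_of_disjoint (himg_disj A₀ A₁ 0 1 (by norm_num)), himg_card,
      himg_card, himg_card]
    exact disjoint_union_left.2 ⟨himg_disj A₀ A₂ 0 2 (by norm_num), himg_disj A₁ A₂ 1 2 (by norm_num)⟩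
  have hPcard : #P = #B₀ + #B₁ + #B₂ := by
    rw [hPeq, card_union_of_disjoint, card_union_of_disjoint (himg_disj B₀ B₁ 0 1 (by norm_num)), himg_card,
      himg_card, himg_card]
    exact disjoint_union_left.2 ⟨himg_disj B₀ B₂ 0 2 (by norm_num), himg_disj B₁ B₂ 1 2 (by norm_num)⟩
  -- the injection maps the negative units in `𝒳` to positive units in `𝒳`
  have hle : #N ≤ #P := by
    refine card_le_card_of_injOn φ (fun u hu => ?_) (fun u hu u' hu' h => ?_)
    · rw [mem_coe, hN, mem_filter, mem_product, mem_range, memD] at hu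
      obtain ⟨⟨⟨-, hx⟩, -⟩, hneg⟩ := hu
      obtain ⟨hpos, ha, hb⟩ := hφ u hneg
      rw [mem_coe, hP, mem_filter, mem_product, mem_range, memD]
      refine ⟨⟨⟨hpos.1, h𝒳 (Prod.mk_le_mk.2 ⟨ha, hb⟩) hx⟩, ?_⟩, hpos⟩
      rcases hpos.2 with ⟨ht, -⟩ | ⟨ht, -⟩ | ⟨ht, -⟩ <;> omega
    · rw [mem_coe, hN, mem_filter] at hu hu'
      exact hinj hu.2 hu'.2 h
  -- bookkeeping
  rw [vSumT_eq_units]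
  unfold posUnits colPosUnits rowPosUnits colNegUnits rowNegUnits
  rw [hN₀, hN₁, hN₂, hP₀, hP₁, hP₂]
  rw [hNcard, hPcard] at hle
  push_cast
  omega

end Summit.CriticalPhenomena.PercolationContinuityZ3.Theorems.ThreePartition

end
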